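import Mathlib.RingTheory.Ideal.GoingUp
import Mathlib.RingTheory.LocalRing.MaximalIdeal.Basic
import HarnessLib

/-!
# Crux `Picover` (stmt-ResolutionOfSingularities-0554), line `degree-p-tower`:
# a radicial integral extension of a local ring is local

Registered helper `isLocalRing_of_forall_pow_mem_range`. Setting: `R` a local ring (the stalk
`𝒪_{W,w}` of the base), `S` a nontrivial integral `R`-algebra with `s ^ p ∈ R` for every `s : S`
(the stalk over `w` of the normalised purely inseparable degree-`p` cover). Claim: `S` is local,
i.e. the cover has exactly one point over `w`.

Proof (no characteristic hypothesis is used). `S` is nontrivial, so it has a maximal ideal. If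
`M₁, M₂` are maximal ideals of `S`, both contract to maximal ideals of `R` (integrality,
`Ideal.isMaximal_comap_of_isIntegral_of_isMaximal`), hence both contract to the unique maximal
ideal `𝔪` of `R`. For `s ∈ M₁` write `s ^ p = algebraMap R S r`; then `r ∈ comap M₁ = 𝔪 = comap M₂`,
so `s ^ p ∈ M₂` and `s ∈ M₂` as `M₂` is prime. Thus `M₁ ≤ M₂`, so `M₁ = M₂` by maximality, and
`IsLocalRing.of_unique_max_ideal` concludes. No statement item is restated.
-/

set_option linter.dupNamespace false -- mandated namespace of this single-conjunct summit

universe u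

namespace Summit.ResolutionOfSingularities.ResolutionOfSingularities.Theorems.Picover.RadicialLocal

/-- **A radicial integral extension of a local ring is local.** If `R` is local, `S` is a
nontrivial integral `R`-algebra and every `s : S` has `s ^ p` in the image of `R`, then `S` is a
local ring: any two maximal ideals of `S` contract to the maximal ideal of `R`, and `s ^ p ∈ R`
forces each maximal ideal of `S` to be contained in every other one. [folklore] -/
theorem isLocalRing_of_forall_pow_mem_range : ∀ {p : ℕ} [Fact p.Prime] {R S : Type u} [CommRing R] [IsLocalRing R] [CommRing S] [Nontrivial S] [Algebra R S] [Algebra.IsIntegral R S] [FaithfulSMul R S], (∀ s : S, s ^ p ∈ (algebraMap R S).range) → IsLocalRing S := by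
  intro p hp R S _ _ _ _ _ _ _ h
  -- every maximal ideal of `S` contracts to the maximal ideal of `R`
  have hcomap : ∀ M : Ideal S, M.IsMaximal →
      M.comap (algebraMap R S) = IsLocalRing.maximalIdeal R := by
    intro M hM
    exact IsLocalRing.eq_maximalIdeal (Ideal.isMaximal_comap_of_isIntegral_of_isMaximal M)
  -- hence any maximal ideal is contained in any other one
  have hle : ∀ M₁ M₂ : Ideal S, M₁.IsMaximal → M₂.IsMaximal → M₁ ≤ M₂ := by
    intro M₁ M₂ hM₁ hM₂ s hs
    obtain ⟨r, hr⟩ := h s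
    have hr₁ : r ∈ M₁.comap (algebraMap R S) := by
      rw [Ideal.mem_comap, hr]
      exact M₁.pow_mem_of_mem hs p hp.out.pos
    rw [hcomap M₁ hM₁, ← hcomap M₂ hM₂, Ideal.mem_comap, hr] at hr₁
    exact hM₂.isPrime.mem_of_pow_mem p hr₁
  obtain ⟨M, hM⟩ := Ideal.exists_maximal S
  exact IsLocalRing.of_unique_max_ideal
    ⟨M, hM, fun N hN => hN.eq_of_le hM.ne_top (hle N M hN hM)⟩

end Summit.ResolutionOfSingularities.ResolutionOfSingularities.Theorems.Picover.RadicialLocal
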